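/-
Copyright: the b2b-balaban T⁴-continuum CRUX team, row NE7b, leaf lineage `t4-ne7b-formalise-leaf-02` (gen 133). Project licence.
-/
import Summits.QuantumFields.BalabanUV.T4Continuum.Spine.NE7b.OneStepCoarseCurlL2
import Summits.QuantumFields.BalabanUV.T4Continuum.Spine.NE7b.OneStepRemainderTorus
import Summits.QuantumFields.BalabanUV.T4Continuum.Spine.NE7b.OneStepAveragePeriodicity
import Summits.QuantumFields.BalabanUV.T4Continuum.Spine.NE7b.AveragedCurlFormSplit

/-!
# PROP. 5.4, FIRST DISPLAY, AT ONE STEP ON THE TWO-SCALE TORUS — EVERY LETTER BY VALUE: for `LM`-periodic `(V₀, A)` with `V₀ = ι ∘ U`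
# unitary and (44) `‖V₀(∂p) − 1‖ ≤ α₀`, `512(d+1)(d+4)L²α₀ ≤ 1`, `1 ≤ L`, `1 < M`:
# `Σ_P ‖∂̄_{V̄₀}(L⁻¹·L(Q(V₀)A))(P)‖² ≤ 2p_M·Σ_q ‖F_A(q)‖² + (2q_M + 2·1²·4·2(d−1)·c_E)·Σ_b ‖A(b)‖²` on `(ℤ∕M)^d`, with
# `p_M = 2L^{2−d}(1+2Lα₀)²`, `q_M = 4(d−1)(L+2)²L^{−d}ε₁²`, `c_E = (50(d+1)ε₂)²·2d`, `ε₁ = 2L(L+1)α₀ + 1920(d+1)(d+4)L²α₀`, `ε₂ = 16(d+1)(d+4)L²α₀`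
# — `…AveragedCurlFormSplit.curlForm_letter_of_split` (the split `Q = M + E`) with `hM` := `…OneStepCoarseCurlL2.sum_sq_coarseCurl_le` (Lemma CS
# at `k = 1`, read on torus coarse 1-forms through `…OneStepAveragePeriodicity`'s wrap lemma), `hE` := `…OneStepRemainderTorus.sum_normSq_remainder_torus_le`
# ((R-M) at `k = 1`), `ℓ = 1` (unitarity of the transports `V̄₀`), `a = 4`, `b = 2(d−1)` (`…TorusPlaquetteIncidence`)
# (row NE7b, node U5c; `HOME/b2b-balaban-r1/SectE-interface-proof.md` §5.4 first display at `k = 1`: «`F(QA) ≤ 2Σ_P|∂_V M_kA(P)|² + 2Σ_P|∂_V E_kA(P)|²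
# ≤ 16‖D_UA‖² + (64(d−1)c_g² + 16d(1+ε_F)²c_E²)ε_F²‖A‖²`»; E-side key reading — THE JUNCTION of this lineage's `k = 1` chain: g132's (cc″)(1))

Cell `pub-balaban`, sub-cell `t4`, spine estimate NE7b (`T4WeightBudget.RelWeightBound`; the cell's OWN estimate — NOT PRINTED in
[Bałaban 1983–89], NOT PROVED).  Crux-route work under `Spine/NE7b/` by the row's E-side ∕ key-readings ∕ lattice-geometry leaf lineage; a
[folklore] junction BY NAME of four row modules (`…AveragedCurlFormSplit` p382311, `…OneStepCoarseCurlL2` p388049, `…OneStepRemainderTorus`,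
`…OneStepAveragePeriodicity` — this gen) and `…TorusPlaquetteIncidence` (gen 131); NOTHING of Bałaban's is asserted beyond what those modules
prove; no `T4Continuum/Support` leaf typed; no `def`, no notation, no instance — the coarse covariant curl `X`, the base points `qb`, the
plaquette-to-bonds map `ι4` and the torus sizes `Fq`, `Ab` are carried by characterising hypotheses (`hX`, `hqb`, `hι4`, `hF`, `hA` — the last two
INHABITED for periodic data by `…OneStepAveragePeriodicity.exists_fineCurl_torus ∕ exists_bondSize_torus`); zero `sorry`.

THE OBJECTS.  Coarse torus `(ℤ∕M)^d` (sites `y`, bonds `(y, κ)`, plaquettes `P = (y, κ < μ)`), fine torus `(ℤ∕LM)^d`; [B7]'s `ℤ^d` objects read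
at the base points `qb y = L·y`: the transports `u₁ = V̄₀(qb y, κ)`, `u₂ = V̄₀(qb y + Le_κ, μ)`, `u₃ = V̄₀(qb y + Le_μ, κ)`, `u₄ = V̄₀(qb y, μ)`
(`B7Prop1Explicit.bavg`), and for a TORUS coarse 1-form `B : (ℤ∕M)^d → (directions) → 𝔸` the covariant coarse curl
`X_P(B) = ‖B(y,κ) + R(u₁)B(y+e_κ,μ) − R(u₁u₂u₃⁻¹)B(y+e_μ,κ) − R(u₁u₂u₃⁻¹u₄⁻¹)B(y,μ)‖` (`hX`; `R = conjR`); the three coarse 1-forms of the split: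
`Q A = (y,κ) ↦ L⁻¹·linQcov L V₀ A (qb y) κ` (the full linear one-step average (122), unit-normalised), `M A = (y,κ) ↦ Q0cov L V₀ A (qb y) κ`
((125)'s main part), `E A = Q A − M A`; the fine sizes `Fq (tcls y, a) = ‖(R_{0,y}A)(∂p_a)‖` (`hF`), `Ab (tcls y, ν) = ‖A(y,ν)‖` (`hA`).

WHAT IS PROVED ([folklore]):
* §1 the curl functional's letters: `coarseCurl_add` (additivity in `B`), **`abs_X_add_le`** (ACFS's `hsub`), `bavg_mem_U1` (the transports
  are in the unit-ball class: `B7Prop2Explicit.bavg_mem_unitaryUnits` + `unitaryUnits_le_U1`, block loops `≤ 1∕32` by `norm_Wcx_sub_one_le`),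
  **`abs_X_le_sum_bonds`** (ACFS's `hloc` with `ℓ = 1`: `|X_P(B)| ≤ Σ_{c ∈ bonds of P} ‖B(c)‖`, `B7Prop3GeneralRotated.norm_conjR_le` + the four
  bonds distinct for `1 < M`, `…TorusPlaquetteIncidence.plaquetteBonds_injective`).
* §2 **`sum_sq_X_main_le`** — ACFS's `hM` BY VALUE: `Σ_P X_P(M A)² ≤ p_M·Σ_q Fq q² + q_M·Σ_b Ab b²` (`…OneStepCoarseCurlL2.sum_sq_coarseCurl_le`
  with its `hXv` discharged through `…OneStepAveragePeriodicity.apply_qb_add_single` — `Q₀A` is `LM`-periodic — and its `Sq ∕ Bd ∕ Gr` instantiated).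
* §3 **`sum_sq_X_linQcov_le`** — THE DISPLAY: `Σ_P X_P(Q A)² ≤ 2p_M·Σ_q Fq q² + (2q_M + 2·(1²·4·2(d−1)·c_E))·Σ_b Ab b²` VERBATIM in
  `curlForm_letter_of_split`'s output shape; `sum_sq_X_linQcov_le'` — the same with the product of letters multiplied out.

HONEST SHAPE.  Against the memo's Prop. 5.4 at `k = 1`: `p = 2p_M = 4L^{2−d}(1+2Lα₀)²` (print `16`; lattice units, before the `L²(η)` normalisation
of the coarse curl and of `‖D_UA‖²`, `‖A‖²` — NOT HERE), `q = 8(d−1)(L+2)²L^{−d}ε₁² + 16(d−1)·(50(d+1)ε₂)²·2d = O(d⁶L⁴α₀²)` (print `c₃ε_F²`).  NOT HERE: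
the `L²(η)` ∕ `η`-unit normalisation and the identification with CED's `(p, q)` and `Dsq ∕ NΩ` (`…CurlFormEnergyDomination.h1_of_letters`'s `hF` in
print's units), (3.4) ∕ `κ₁, κ₂`, `k > 1` (composed averaging (134) vs (R-M) (139)–(143)), anything of Bałaban's ((A3) ∕ (A1c), NC-NE7b-α UNRULED);
the cell's `U(n)`: take `ι = Unitary.toUnits` with `…OneStepCoarseCurlBound` §2's two letters (no separate file — cf. OSCL2U p388181 `dedup`).
HONEST BY VALUE (the pricing desk's located ask, PRICING v123 F734 ∕ F738: «which `α₀` regime does the display serve»).  The display is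
TRUE on the whole admissible range `512(d+1)(d+4)L²α₀ ≤ 1`, but its constants are SMALL only far inside it: at `d = 4`, `L = 2` the edge is
`α₀ = 1∕81920`, where `ε₁ ≈ 3.75`, `q_M = 12ε₁² ≈ 168.8`, `c_E ≈ 488.3`, `p = 1.0·(1+4α₀)² ≈ 1`, `q ≈ 2.4·10⁴`; in general (`d = 4`, `L = 2`)
`q ≈ 1.6·10¹⁴·α₀²` (the (R-M) term `16(d−1)·2d·(50(d+1)ε₂)²` dominates the Lemma-CS term `24ε₁²` by `≈ 70×`), so `q ≤ 1` iff `α₀ ≲ 7.9·10⁻⁸`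
and `q ≤ 10⁻²` iff `α₀ ≲ 8·10⁻⁹` — the regime `α₀ = O(d⁻³L⁻²)`, squared, of print's «`c₃c₀ε_F² ≤ 2`» (memo §5.4; `ε_F = O(1)Mα₀` under (3.35)).
The curl constant `p ≈ L^{2−d}·4` does not depend on `α₀` (print's `16` at `p_M = 8`; the tree's sharp count gives `p_M = 2L^{2−d}(1+2Lα₀)²`).
BY-NAME EFFECT ON THE WALL: NONE (the (h1) slot's first display at `k = 1` by value; the wall is (R2)).  NE7b NOT PRINTED ∕ NOT PROVED; spine
PROVED 0∕9; rung (B)+1 on a FINITE torus — NOT infinite volume, NOT the mass gap, NOT Clay.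
HONEST DEPENDENCY: continuum YM on T⁴ ⇐ BetaPertH ∧ nine spine estimates (0/9 proved); BetaPertH ⇐ (D1) ∧ (D4) ∧ CAP+tail; G-an2-4 gates
asym, D1 and NE2/3/4.
-/

set_option autoImplicit false

noncomputable section

open scoped BigOperators
open Finset
open Literature.MathematicalPhysics.QuantumFieldTheory.Balaban1983to89
open Literature.MathematicalPhysics.QuantumFieldTheory.Balaban1983to89 (GaugeGroup dist1)
open Literature.MathematicalPhysics.QuantumFieldTheory.Balaban1983to89.B7Prop1Explicit (Site e hol seg treeWord boxVec bavg plaqWord U1 Wcx)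
open Literature.MathematicalPhysics.QuantumFieldTheory.Balaban1983to89.B7Prop2Explicit (unitaryUnits unitaryUnits_le_U1 bavg_mem_unitaryUnits)
open Literature.MathematicalPhysics.QuantumFieldTheory.Balaban1983to89.B7Eq78Linearization (conjR conjR_add)
open Literature.MathematicalPhysics.QuantumFieldTheory.Balaban1983to89.B7Prop3GeneralRotated (tsum norm_conjR_le)
open Literature.MathematicalPhysics.QuantumFieldTheory.Balaban1983to89.B7Prop3GeneralLinear (Q0cov linQcov)
open Literature.MathematicalPhysics.QuantumFieldTheory.Balaban1983to89.T4TermwiseTorus (tcls tlift IsPeriodic)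

namespace Summit.QuantumFields.BalabanUV.T4Continuum.NE7b.OneStepCurlFormDisplay

variable {d : ℕ}
variable {𝔸 : Type*} [CStarAlgebra 𝔸] [Nontrivial 𝔸] {G : Type*} [GaugeGroup G]
  (ι : G →* 𝔸ˣ) (hιu : ∀ g, ι g ∈ unitaryUnits 𝔸) (hdist : ∀ g, ‖((ι g : 𝔸ˣ) : 𝔸) - 1‖ = dist1 g)
  (L M : ℕ) [NeZero M] [NeZero (L * M)] [Fact (1 < M)] (hL : 1 ≤ L) {α₀ : ℝ} (hα₀ : 0 ≤ α₀)
  (hsmall : 512 * (d + 1) * (d + 4) * (L : ℝ) ^ 2 * α₀ ≤ 1)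
  (U : Site d → Fin d → G) {V₀ : Site d → Fin d → 𝔸ˣ} (hV₀ : ∀ y ν, V₀ y ν = ι (U y ν))
  (h44 : ∀ (x : Site d) (κ κ' : Fin d), κ ≠ κ' → ‖((hol V₀ x (plaqWord κ κ') : 𝔸ˣ) : 𝔸) - 1‖ ≤ α₀)
  (hVper : IsPeriodic (L * M) V₀)
  (A : Site d → Fin d → 𝔸) (hAper : IsPeriodic (L * M) A)
  -- the two-scale torus: base points, the plaquette-to-bonds map of `(ℤ∕M)^d`
  (qb : (Fin d → ZMod M) → Site d) (hqb : ∀ y i, qb y i = (L : ℤ) * (((y i).val : ℕ) : ℤ))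
  (ι4 : (Fin d → ZMod M) × {a : Fin d × Fin d // a.1 < a.2} → Fin 4 → (Fin d → ZMod M) × Fin d)
  (hι4 : ∀ x a, ι4 (x, a) = ![(x, a.1.1), (x + Pi.single a.1.1 1, a.1.2), (x + Pi.single a.1.2 1, a.1.1), (x, a.1.2)])
  -- the covariant coarse curl of a torus coarse 1-form, characterised
  (X : (Fin d → ZMod M) × {a : Fin d × Fin d // a.1 < a.2} → ((Fin d → ZMod M) → Fin d → 𝔸) → ℝ)
  (hX : ∀ (y : Fin d → ZMod M) (a : {a : Fin d × Fin d // a.1 < a.2}) (B : (Fin d → ZMod M) → Fin d → 𝔸), X (y, a) B =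
    ‖B y a.1.1 + conjR (bavg L V₀ (qb y) a.1.1) (B (y + Pi.single a.1.1 1) a.1.2)
      - conjR (bavg L V₀ (qb y) a.1.1 * bavg L V₀ (qb y + (L : ℤ) • e a.1.1) a.1.2 * (bavg L V₀ (qb y + (L : ℤ) • e a.1.2) a.1.1)⁻¹)
          (B (y + Pi.single a.1.2 1) a.1.1)
      - conjR (bavg L V₀ (qb y) a.1.1 * bavg L V₀ (qb y + (L : ℤ) • e a.1.1) a.1.2 * (bavg L V₀ (qb y + (L : ℤ) • e a.1.2) a.1.1)⁻¹
          * (bavg L V₀ (qb y) a.1.2)⁻¹) (B y a.1.2)‖)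
  -- the fine torus sizes, characterised (inhabited for periodic data: `…OneStepAveragePeriodicity` §3)
  (Fq : (Fin d → ZMod (L * M)) × {a : Fin d × Fin d // a.1 < a.2} → ℝ)
  (hF : ∀ (y : Site d) (a : {a : Fin d × Fin d // a.1 < a.2}), Fq (tcls (L * M) y, a) = ‖tsum V₀ A y (plaqWord a.1.1 a.1.2)‖)
  (Ab : (Fin d → ZMod (L * M)) × Fin d → ℝ) (hA : ∀ (y : Site d) (ν : Fin d), Ab (tcls (L * M) y, ν) = ‖A y ν‖)

/-! ## §1 The curl functional's letters: subadditivity (`hsub`) and locality with `ℓ = 1` (`hloc`) -/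

omit [Nontrivial 𝔸] in
/-- `‖a + b − c − e‖ ≤ ‖a‖ + ‖b‖ + ‖c‖ + ‖e‖`. [folklore] -/
theorem norm_add_sub_sub_le (a b c e : 𝔸) : ‖a + b - c - e‖ ≤ ‖a‖ + ‖b‖ + ‖c‖ + ‖e‖ := by
  have h1 := norm_sub_le (a + b - c) e
  have h2 := norm_sub_le (a + b) c
  have h3 := norm_add_le a b
  linarith

omit [Nontrivial 𝔸] [NeZero M] [Fact (1 < M)] in
/-- the expression under the norm of `X_P` is additive in the coarse 1-form. [folklore] -/
theorem coarseCurl_add (u₁ u₂ u₃ : 𝔸ˣ) (B₁ B₂ : (Fin d → ZMod M) → Fin d → 𝔸) (y y₁ y₂ : Fin d → ZMod M) (κ μ : Fin d) :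
    (B₁ + B₂) y κ + conjR u₁ ((B₁ + B₂) y₁ μ) - conjR u₂ ((B₁ + B₂) y₂ κ) - conjR u₃ ((B₁ + B₂) y μ)
      = (B₁ y κ + conjR u₁ (B₁ y₁ μ) - conjR u₂ (B₁ y₂ κ) - conjR u₃ (B₁ y μ))
        + (B₂ y κ + conjR u₁ (B₂ y₁ μ) - conjR u₂ (B₂ y₂ κ) - conjR u₃ (B₂ y μ)) := by
  simp only [Pi.add_apply, conjR_add]
  abel

include hX in
omit [Nontrivial 𝔸] [NeZero M] [NeZero (L * M)] [Fact (1 < M)] in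
/-- **`hsub`**: `|X_P(B₁ + B₂)| ≤ |X_P(B₁)| + |X_P(B₂)|` (a norm of an additive expression). [folklore] -/
theorem abs_X_add_le (P : (Fin d → ZMod M) × {a : Fin d × Fin d // a.1 < a.2}) (B₁ B₂ : (Fin d → ZMod M) → Fin d → 𝔸) :
    |X P (B₁ + B₂)| ≤ |X P B₁| + |X P B₂| := by
  obtain ⟨y, a⟩ := P
  rw [hX, hX, hX, abs_of_nonneg (norm_nonneg _), abs_of_nonneg (norm_nonneg _), abs_of_nonneg (norm_nonneg _), coarseCurl_add]
  exact norm_add_le _ _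

include hιu hL hα₀ hsmall hV₀ h44 in
/-- **THE TRANSPORTS ARE IN THE UNIT-BALL CLASS**: `V̄₀(c) ∈ U1` for unitary `V₀` under (44) and `512(d+1)(d+4)L²α₀ ≤ 1` (block loops within `1∕32`
of `1`, so `B7Prop2Explicit.bavg_mem_unitaryUnits` applies; then `unitaryUnits_le_U1`). [folklore] -/
theorem bavg_mem_U1 (q : Site d) (κ : Fin d) : bavg L V₀ q κ ∈ U1 𝔸 := by
  have hV₀u : ∀ y ν, V₀ y ν ∈ unitaryUnits 𝔸 := fun y ν => by rw [hV₀]; exact hιu _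
  have hV₀1 : ∀ y ν, V₀ y ν ∈ U1 𝔸 := fun y ν => unitaryUnits_le_U1 (hV₀u y ν)
  have hd0 : (0 : ℝ) ≤ (d + 1) * (d + 4) * (L : ℝ) ^ 2 * α₀ := by positivity
  have hW : ∀ r : Fin d → Fin L, ‖((Wcx L V₀ q κ (boxVec L r) : 𝔸ˣ) : 𝔸) - 1‖ ≤ 1 / 4 := fun r =>
    (B7Prop2Explicit.norm_Wcx_sub_one_le L hL V₀ hV₀1 hα₀ hsmall h44 q κ r).trans (by nlinarith)
  exact unitaryUnits_le_U1 (bavg_mem_unitaryUnits hV₀u L q κ hW)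

include hιu hL hα₀ hsmall hV₀ h44 hι4 hX in
omit [NeZero M] [NeZero (L * M)] in
/-- **`hloc` WITH `ℓ = 1`**: `|X_P(B)| ≤ 1·Σ_{c ∈ bonds of P} ‖B(c)‖` — the rotations `R(u)`, `u ∈ U1`, do not increase norms, and the four bonds of
a plaquette of `(ℤ∕M)^d` are distinct for `1 < M`. [folklore] -/
theorem abs_X_le_sum_bonds (P : (Fin d → ZMod M) × {a : Fin d × Fin d // a.1 < a.2}) (B : (Fin d → ZMod M) → Fin d → 𝔸) :
    |X P B| ≤ 1 * ∑ c ∈ univ.image (ι4 P), ‖B c.1 c.2‖ := by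
  classical
  have hu : ∀ q κ, bavg L V₀ q κ ∈ U1 𝔸 := fun q κ => bavg_mem_U1 ι hιu L hL hα₀ hsmall U hV₀ h44 q κ
  obtain ⟨y, a⟩ := P
  rw [one_mul, Finset.sum_image (TorusPlaquetteIncidence.plaquetteBonds_injective ι4 hι4 (y, a)).injOn, Fin.sum_univ_four, hι4, hX,
    abs_of_nonneg (norm_nonneg _)]
  simp only [Matrix.cons_val_zero, Matrix.cons_val_one, Matrix.cons_val]
  have h1 := norm_conjR_le (hu (qb y) a.1.1) (B (y + Pi.single a.1.1 1) a.1.2)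
  have h2 := norm_conjR_le ((U1 𝔸).mul_mem ((U1 𝔸).mul_mem (hu (qb y) a.1.1) (hu (qb y + (L : ℤ) • e a.1.1) a.1.2))
    ((U1 𝔸).inv_mem (hu (qb y + (L : ℤ) • e a.1.2) a.1.1))) (B (y + Pi.single a.1.2 1) a.1.1)
  have h3 := norm_conjR_le ((U1 𝔸).mul_mem ((U1 𝔸).mul_mem ((U1 𝔸).mul_mem (hu (qb y) a.1.1) (hu (qb y + (L : ℤ) • e a.1.1) a.1.2))
    ((U1 𝔸).inv_mem (hu (qb y + (L : ℤ) • e a.1.2) a.1.1))) ((U1 𝔸).inv_mem (hu (qb y) a.1.2))) (B y a.1.2)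
  refine (norm_add_sub_sub_le _ _ _ _).trans ?_
  linarith

/-! ## §2 The main-part letter `hM` by value: `…OneStepCoarseCurlL2` read on torus coarse 1-forms -/

include hιu hdist hL hα₀ hsmall hV₀ h44 hVper hAper hqb hX hF hA in
omit [Fact (1 < M)] in
/-- **`hM` BY VALUE**: `Σ_P X_P(M A)² ≤ p_M·Σ_q Fq q² + q_M·Σ_b Ab b²`, `M A = (y,κ) ↦ Q0cov L V₀ A (qb y) κ`, `p_M = 2L^{−d}(L(1+2Lα₀))²`,
`q_M = 4(d−1)(L+2)²L^{−d}ε₁²` — `…OneStepCoarseCurlL2.sum_sq_coarseCurl_le`, its `hXv` discharged by the wrap lemma (`Q₀A` is `LM`-periodic: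
`…OneStepAveragePeriodicity.isPeriodic_Q0cov ∕ apply_qb_add_single`), its `Sq ∕ Bd ∕ Gr` instantiated by their characterising images. [folklore] -/
theorem sum_sq_X_main_le :
    ∑ P, X P (fun y κ => Q0cov L V₀ A (qb y) κ) ^ 2
      ≤ 2 * (1 / (L : ℝ) ^ d) * ((L : ℝ) * (1 + 2 * ((L : ℝ) * α₀))) ^ 2 * ∑ q, Fq q ^ 2
        + 4 * ((d - 1 : ℕ) : ℝ) * ((L : ℝ) + 2) ^ 2 * (1 / (L : ℝ) ^ d)
          * (2 * (L : ℝ) * ((L : ℝ) + 1) * α₀ + 1920 * (d + 1) * (d + 4) * (L : ℝ) ^ 2 * α₀) ^ 2 * ∑ b, Ab b ^ 2 := by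
  have hQper : IsPeriodic (L * M) (Q0cov L V₀ A) := OneStepAveragePeriodicity.isPeriodic_Q0cov L hVper hAper
  -- OSCL2's `hXv` for `Xv := X ∘ (M A)`: the torus neighbours of the base point read through the wrap lemma
  have hXv : ∀ p : (Fin d → ZMod M) × {a : Fin d × Fin d // a.1 < a.2}, X p (fun y κ => Q0cov L V₀ A (qb y) κ) =
      ‖Q0cov L V₀ A (qb p.1) p.2.1.1 + conjR (bavg L V₀ (qb p.1) p.2.1.1) (Q0cov L V₀ A (qb p.1 + (L : ℤ) • e p.2.1.1) p.2.1.2)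
        - conjR (bavg L V₀ (qb p.1) p.2.1.1 * bavg L V₀ (qb p.1 + (L : ℤ) • e p.2.1.1) p.2.1.2
            * (bavg L V₀ (qb p.1 + (L : ℤ) • e p.2.1.2) p.2.1.1)⁻¹) (Q0cov L V₀ A (qb p.1 + (L : ℤ) • e p.2.1.2) p.2.1.1)
        - conjR (bavg L V₀ (qb p.1) p.2.1.1 * bavg L V₀ (qb p.1 + (L : ℤ) • e p.2.1.1) p.2.1.2
            * (bavg L V₀ (qb p.1 + (L : ℤ) • e p.2.1.2) p.2.1.1)⁻¹ * (bavg L V₀ (qb p.1) p.2.1.2)⁻¹) (Q0cov L V₀ A (qb p.1) p.2.1.2)‖ := by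
    rintro ⟨y, a⟩
    rw [hX]
    dsimp only
    rw [congrFun (OneStepAveragePeriodicity.apply_qb_add_single L M qb hqb hQper y a.1.1) a.1.2,
      congrFun (OneStepAveragePeriodicity.apply_qb_add_single L M qb hqb hQper y a.1.2) a.1.1]
  -- OSCL2's torus Finsets `Sq ∕ Bd ∕ Gr` are determined by their characterising equations: let unification name them (`_` + `rfl`)
  have h := OneStepCoarseCurlL2.sum_sq_coarseCurl_le ι hιu hdist L M hL hα₀ hsmall U hV₀ h44 A
    _ (fun _ _ => rfl) _ (fun _ _ => rfl) _ (fun _ _ => rfl)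
    qb hqb (fun P => X P (fun y κ => Q0cov L V₀ A (qb y) κ)) hXv Fq hF Ab hA
  have hre : ∑ q, ((L : ℝ) * (1 + 2 * ((L : ℝ) * α₀)) * Fq q) ^ 2 = ((L : ℝ) * (1 + 2 * ((L : ℝ) * α₀))) ^ 2 * ∑ q, Fq q ^ 2 := by
    rw [Finset.mul_sum]
    exact Finset.sum_congr rfl fun q _ => by ring
  rw [hre] at h
  calc _ ≤ _ := h
    _ = _ := by ring

/-! ## §3 THE DISPLAY: the split `Q = M + E` with every letter by value -/

include hιu hdist hL hα₀ hsmall hV₀ h44 hVper hAper hqb hι4 hX hF hA in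
/-- **PROP. 5.4, FIRST DISPLAY, AT `k = 1` ON THE TWO-SCALE TORUS, EVERY LETTER BY VALUE** — VERBATIM the output shape of
`…AveragedCurlFormSplit.curlForm_letter_of_split` (`2p_M·Dsq + (2q_M + 2(ℓ²ab·c_E))·NΩ` with `ℓ = 1`, `a = 4`, `b = 2(d−1)`): for the unit-normalised
linear one-step average `Q A = (y,κ) ↦ L⁻¹·linQcov L V₀ A (qb y) κ`,
`Σ_P X_P(Q A)² ≤ 2·p_M·Σ_q Fq q² + (2·q_M + 2·(1²·4·2(d−1)·c_E))·Σ_b Ab b²`. [folklore] -/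
theorem sum_sq_X_linQcov_le :
    ∑ P, X P (fun y κ => (L : ℝ)⁻¹ • linQcov L V₀ A (qb y) κ) ^ 2
      ≤ 2 * (2 * (1 / (L : ℝ) ^ d) * ((L : ℝ) * (1 + 2 * ((L : ℝ) * α₀))) ^ 2) * ∑ q, Fq q ^ 2
        + (2 * (4 * ((d - 1 : ℕ) : ℝ) * ((L : ℝ) + 2) ^ 2 * (1 / (L : ℝ) ^ d)
              * (2 * (L : ℝ) * ((L : ℝ) + 1) * α₀ + 1920 * (d + 1) * (d + 4) * (L : ℝ) ^ 2 * α₀) ^ 2)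
          + 2 * ((1 : ℝ) ^ 2 * (4 : ℕ) * ((2 * (d - 1) : ℕ) : ℝ)
              * ((50 * (d + 1) * (16 * (d + 1) * (d + 4) * (L : ℝ) ^ 2 * α₀)) ^ 2 * ((2 * d : ℕ) : ℝ))))
          * ∑ b, Ab b ^ 2 := by
  classical
  have hV₀u : ∀ y ν, V₀ y ν ∈ unitaryUnits 𝔸 := fun y ν => by rw [hV₀]; exact hιu _
  have hV₀1 : ∀ y ν, V₀ y ν ∈ U1 𝔸 := fun y ν => unitaryUnits_le_U1 (hV₀u y ν)
  have hM2 : 2 ≤ M := (Fact.out : 1 < M)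
  -- the letters
  have hMl : ∀ _ : Unit, ∑ P, X P (fun y κ => Q0cov L V₀ A (qb y) κ) ^ 2
      ≤ (2 * (1 / (L : ℝ) ^ d) * ((L : ℝ) * (1 + 2 * ((L : ℝ) * α₀))) ^ 2) * ∑ q, Fq q ^ 2
        + (4 * ((d - 1 : ℕ) : ℝ) * ((L : ℝ) + 2) ^ 2 * (1 / (L : ℝ) ^ d)
            * (2 * (L : ℝ) * ((L : ℝ) + 1) * α₀ + 1920 * (d + 1) * (d + 4) * (L : ℝ) ^ 2 * α₀) ^ 2) * ∑ b, Ab b ^ 2 := fun _ => by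
    have h := sum_sq_X_main_le ι hιu hdist L M hL hα₀ hsmall U hV₀ h44 hVper A hAper qb hqb X hX Fq hF Ab hA
    linarith
  have hEl : ∀ _ : Unit, ∑ c : (Fin d → ZMod M) × Fin d,
      ‖((fun y κ => (L : ℝ)⁻¹ • linQcov L V₀ A (qb y) κ) - (fun y κ => Q0cov L V₀ A (qb y) κ)) c.1 c.2‖ ^ 2
        ≤ ((50 * (d + 1) * (16 * (d + 1) * (d + 4) * (L : ℝ) ^ 2 * α₀)) ^ 2 * ((2 * d : ℕ) : ℝ)) * ∑ β, Ab β ^ 2 := fun _ => by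
    simp only [Pi.sub_apply]
    exact OneStepRemainderTorus.sum_normSq_remainder_torus_le L M hL hM2 hV₀1 hα₀ hsmall h44 qb hqb A Ab hA
  have h := AveragedCurlFormSplit.curlForm_letter_of_split (W := Unit) X (abs_X_add_le L M qb X hX)
    (fun P => univ.image (ι4 P)) (fun P => AveragedCurlFormSplit.card_image_four_le (ι4 P))
    (fun c => TorusPlaquetteIncidence.card_plaquettes_through_bond_le ι4 hι4 c)
    (fun B c => ‖B c.1 c.2‖) zero_le_one (abs_X_le_sum_bonds ι hιu L M hL hα₀ hsmall U hV₀ h44 qb ι4 hι4 X hX)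
    (fun _ => fun y κ => (L : ℝ)⁻¹ • linQcov L V₀ A (qb y) κ) (fun _ => fun y κ => Q0cov L V₀ A (qb y) κ)
    (fun _ => (fun y κ => (L : ℝ)⁻¹ • linQcov L V₀ A (qb y) κ) - (fun y κ => Q0cov L V₀ A (qb y) κ))
    (fun _ => (add_sub_cancel _ _).symm) (fun _ => ∑ q, Fq q ^ 2) (fun _ => ∑ b, Ab b ^ 2) hMl hEl ()
  exact h

include hιu hdist hL hα₀ hsmall hV₀ h44 hVper hAper hqb hι4 hX hF hA in
/-- **THE DISPLAY, CONSTANTS MULTIPLIED OUT**: `Σ_P X_P(Q A)² ≤ 4L^{−d}(L(1+2Lα₀))²·Σ_q Fq q² + (8(d−1)(L+2)²L^{−d}ε₁² + 16(d−1)·2d·(50(d+1)ε₂)²)·Σ_b Ab b²`,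
`ε₁ = 2L(L+1)α₀ + 1920(d+1)(d+4)L²α₀`, `ε₂ = 16(d+1)(d+4)L²α₀`. [folklore] -/
theorem sum_sq_X_linQcov_le' (hd : 1 ≤ d) :
    ∑ P, X P (fun y κ => (L : ℝ)⁻¹ • linQcov L V₀ A (qb y) κ) ^ 2
      ≤ 4 * (1 / (L : ℝ) ^ d) * ((L : ℝ) * (1 + 2 * ((L : ℝ) * α₀))) ^ 2 * ∑ q, Fq q ^ 2
        + (8 * ((d : ℝ) - 1) * ((L : ℝ) + 2) ^ 2 * (1 / (L : ℝ) ^ d)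
              * (2 * (L : ℝ) * ((L : ℝ) + 1) * α₀ + 1920 * (d + 1) * (d + 4) * (L : ℝ) ^ 2 * α₀) ^ 2
            + 16 * ((d : ℝ) - 1) * (2 * d) * (50 * (d + 1) * (16 * (d + 1) * (d + 4) * (L : ℝ) ^ 2 * α₀)) ^ 2)
          * ∑ b, Ab b ^ 2 := by
  have h := sum_sq_X_linQcov_le ι hιu hdist L M hL hα₀ hsmall U hV₀ h44 hVper A hAper qb hqb ι4 hι4 X hX Fq hF Ab hA
  have hcast1 : ((d - 1 : ℕ) : ℝ) = (d : ℝ) - 1 := by rw [Nat.cast_sub hd, Nat.cast_one]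
  have hcast2 : ((2 * (d - 1) : ℕ) : ℝ) = 2 * ((d : ℝ) - 1) := by rw [Nat.cast_mul, Nat.cast_sub hd]; norm_num
  have hcast3 : ((2 * d : ℕ) : ℝ) = 2 * (d : ℝ) := by push_cast; ring
  rw [hcast1, hcast2, hcast3] at h
  calc _ ≤ _ := h
    _ = _ := by push_cast; ring

end Summit.QuantumFields.BalabanUV.T4Continuum.NE7b.OneStepCurlFormDisplay

end
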